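import Mathlib
import Literature.Barriers.ValiantsHypothesis.AlgebraicNaturalProofs
import Literature.Computability.AlgebraicComplexity.ValiantClassesProofs
import Literature.Computability.AlgebraicComplexity.ArithCircuitProofs
import Literature.Computability.AlgebraicComplexity.StandardFamilies
import Summits.ValiantsHypothesis.ValiantsHypothesis.Theorems.BarrierLeverSuccinctHittingSetsForVPLevelOne
import Summits.ValiantsHypothesis.ValiantsHypothesis.Theorems.BarrierLeverSuccinctHittingSetsForVPStubRestrict
import Summits.ValiantsHypothesis.ValiantsHypothesis.Theorems.BarrierLeverSuccinctHittingSetsForVPMultilinearSparse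
import Summits.ValiantsHypothesis.ValiantsHypothesis.Theorems.BarrierLeverSuccinctHittingSetsForVPDimensionCount
import HarnessLib

/-!
# Crux `BarrierLever.SuccinctHittingSetsForVP` (stmt-ValiantsHypothesis-14610) — COORDINATE SLICES:
sparse distinguishers are hit RELATIVE TO ANY coordinate slice that contains a cheap full-support
member (FSV 2018 Thm. 9's mechanism; the narrowed barrier `AlgebraicNaturalProofsNarrow` of the
framework file, `P` = a coordinate slice)

Lean text authored by the cell planner seat `valiant-natproofs-p1` (gen 2, HOME/p1/Chain2.lean §D,
2026-08-25), landed by the prover seat as a helper of the crux (cell `valiant-natproofs`, rung V4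
kill-test item "slice theorem for set-multilinear D"). Unconditional; does NOT close the item.

* `coordSlice good` — polynomials supported on the monomials satisfying `good`
  (`multilinearSlice ℂ n = coordSlice (· ≤ 1)` by `rfl`);
* `isSuccinctHittingSetRel_coordSlice_sparse` — if the slice contains ONE polynomial `f₀` of
  size `≤ n²` whose support is exactly the good monomials of degree `≤ n`, then for `n ≥ 8a + 2`
  every `N^a`-sparse level-`a` distinguisher nonzero somewhere on the slice is nonzero at a member
  of `SmallCircuits ℂ n 3 ∩ slice` (the landed sparse machinery `MultilinearSparseGlue` run inside
  the slice: kill the coordinates outside the slice, shift by `f₀`, plant the sparse witness);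
* `multilinear_instance` — the multilinear slice (`f₀ = ∏ (1 + x_i)`), recovering the landed
  `BarrierLeverSuccinctHittingSetsForVPMultilinearSparse` statement as an instance.
The set-multilinear slices are the sequel `…SetMultilinearSlice.lean`.

References: [ForbesShpilkaVolk2018] §1.2 (slices), Thm. 9, Lemma 32, Cor. 34.
-/

-- layout Summits/ValiantsHypothesis/ValiantsHypothesis forces the duplicated namespace component
set_option linter.dupNamespace false

noncomputable section

namespace Summit.ValiantsHypothesis.ValiantsHypothesis.Theorems.BarrierLever.SuccinctHittingSetsForVP

namespace CoordSlice

open Literature.Barriers.ValiantsHypothesis Literature.Computability.AlgebraicComplexity MvPolynomial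
open Summit.ValiantsHypothesis.ValiantsHypothesis.Theorems.BarrierLever.SuccinctHittingSetsForVP.MultilinearSparseGlue

variable {n : ℕ}

/-- The coordinate slice of a monomial predicate `good`: the polynomials supported on `good`
monomials. `multilinearSlice ℂ n = coordSlice (fun μ => ∀ i, μ i ≤ 1)` by `rfl`. -/
def coordSlice (good : (Fin n →₀ ℕ) → Prop) : Set (MvPolynomial (Fin n) ℂ) :=
  {f | ∀ m ∈ f.support, good m}

/-- The multilinear slice is the coordinate slice of the multilinear monomials. [cite: ForbesShpilkaVolk2018, §1.2] -/
theorem multilinearSlice_eq_coordSlice (n : ℕ) :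
    multilinearSlice ℂ n = coordSlice (fun μ : Fin n →₀ ℕ => ∀ i, μ i ≤ 1) := rfl

/-- Members of the slice have no coefficients outside the good monomials. [cite: ForbesShpilkaVolk2018, Thm. 9] -/
theorem coeff_eq_zero_of_notMem_good {good : (Fin n →₀ ℕ) → Prop} {T : Finset (degLEMonomials n)}
    (hT : ∀ μ : degLEMonomials n, μ ∈ T ↔ good μ)
    {h : MvPolynomial (Fin n) ℂ} (hh : h ∈ coordSlice good)
    {μ : degLEMonomials n} (hμ : μ ∉ T) : coeff (μ : Fin n →₀ ℕ) h = 0 := by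
  rw [← notMem_support_iff]
  intro hmem
  exact hμ ((hT μ).mpr (hh _ hmem))

/-- Killing the coordinates outside the slice does not change the value of `D` at the coefficient
vector of a member of the slice. [cite: ForbesShpilkaVolk2018, Thm. 9] -/
theorem eval_subst_of_mem_coordSlice {good : (Fin n →₀ ℕ) → Prop} {T : Finset (degLEMonomials n)}
    (hT : ∀ μ : degLEMonomials n, μ ∈ T ↔ good μ)
    {h : MvPolynomial (Fin n) ℂ} (hh : h ∈ coordSlice good)
    (D : MvPolynomial (degLEMonomials n) ℂ) :
    eval (coeffVector (degLEMonomials n) h)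
        (aeval (fun μ => if μ ∈ T then (X μ : MvPolynomial (degLEMonomials n) ℂ) else 0) D) =
      eval (coeffVector (degLEMonomials n) h) D := by
  rw [LowDegree.eval_subst]
  have hfun : (fun μ => if μ ∈ T then coeffVector (degLEMonomials n) h μ else 0) =
      coeffVector (degLEMonomials n) h := by
    funext μ
    split_ifs with hμ
    · rfl
    · rw [coeffVector_apply, coeff_eq_zero_of_notMem_good hT hh hμ]
  rw [hfun]

/-- Adding a linear combination of good monomials to a member of the slice stays in the slice.
[folklore] -/
theorem add_sparse_mem_coordSlice {good : (Fin n →₀ ℕ) → Prop} {f₁ : MvPolynomial (Fin n) ℂ}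
    (hf₁ : f₁ ∈ coordSlice good) (S : Finset (degLEMonomials n))
    (hS : ∀ μ ∈ S, good (μ : Fin n →₀ ℕ)) (W : degLEMonomials n → ℂ) :
    f₁ + ∑ μ ∈ S, monomial (μ : Fin n →₀ ℕ) (W μ) ∈ coordSlice good := by
  intro m hm
  rcases Finset.mem_union.mp (support_add hm) with h | h
  · exact hf₁ m h
  · obtain ⟨μ, hμ, hmμ⟩ := Finset.mem_biUnion.mp (support_sum h)
    rw [Finset.mem_singleton.mp (support_monomial_subset hmμ)]
    exact hS μ hμ

/-- **COORDINATE-SLICE THEOREM (PROVED-HERE; FSV Thm. 9's mechanism for an arbitrary coordinate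
slice).** Let `good` be any monomial predicate and `f₁ ∈ SmallCircuits ℂ n 2` an INDICATOR of the
slice: supported on good monomials, coefficient `1` at every good monomial of degree `≤ n`. Then for
`n ≥ 8a + 2` every `C(2n,n)^a`-sparse distinguisher that is nonzero somewhere on `coordSlice good` is
nonzero at a member of `SmallCircuits ℂ n 3 ∩ coordSlice good`. (Kill the bad coordinates, FSV
Lemma 32 with the shift `coeff f₁ = 𝟙_T`, hit with `f₁ + Σ_{ν ∈ supp m} w_ν x^ν`.) The landed
multilinear theorem is the instance `good μ := ∀ i, μ i ≤ 1`, `f₁ := ∏ (1 + x_i)`.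
[cite: ForbesShpilkaVolk2018, Thm. 9 and Lemma 32] -/
theorem isSuccinctHittingSetRel_coordSlice_sparse {n a : ℕ} (hn : 8 * a + 2 ≤ n)
    (good : (Fin n →₀ ℕ) → Prop) (f₁ : MvPolynomial (Fin n) ℂ) (hf₁S : f₁ ∈ SmallCircuits ℂ n 2)
    (hf₁P : f₁ ∈ coordSlice good)
    (hcoef₁ : ∀ μ : degLEMonomials n, good μ → coeff (μ : Fin n →₀ ℕ) f₁ = 1) :
    IsSuccinctHittingSetRel (degLEMonomials n) (coordSlice good) (SmallCircuits ℂ n 3)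
      {D | D.support.card ≤ Nat.choose (2 * n) n ^ a} := by
  classical
  rintro D hD ⟨g, hg, hgne⟩
  have hDa : D.support.card ≤ Nat.choose (2 * n) n ^ a := hD
  haveI : Fintype (degLEMonomials n) := (MultilinearCoords.finite_degLEMonomials n).fintype
  obtain ⟨T, hT⟩ : ∃ T : Finset (degLEMonomials n), ∀ μ : degLEMonomials n, μ ∈ T ↔ good μ :=
    ⟨Finset.univ.filter fun μ : degLEMonomials n => good μ, fun μ => by
      simp only [Finset.mem_filter, Finset.mem_univ, true_and]⟩
  -- Step 1: killing the bad coordinates leaves `D` nonzero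
  have hρ0 : aeval (fun μ => if μ ∈ T then (X μ : MvPolynomial (degLEMonomials n) ℂ) else 0) D ≠ 0 := by
    intro h0
    apply hgne
    rw [← eval_subst_of_mem_coordSlice hT hg D, h0, map_zero]
  -- Step 2: transport to the polynomial ring on the good coordinates
  obtain ⟨E, hE⟩ := exists_rename_eq_subst T D
  have hE0 : E ≠ 0 := by
    rintro rfl
    exact hρ0 (by rw [← hE, map_zero])
  have hEcard : E.support.card ≤ 2 ^ (2 * a * n) := by
    rw [← card_support_rename_val T E, hE]
    exact (card_support_subst_le T D).trans (hDa.trans SparseGlue.choose_pow_le)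
  -- Step 3: FSV Lemma 32 with the all-ones shift: a narrow monomial `m`
  obtain ⟨m, hm, hmcard⟩ :
      ∃ m ∈ (aeval (fun i : ↥T => C (1 : ℂ) + X i) E).support,
        2 ^ m.support.card ≤ E.support.card :=
    ShiftSmallSupport.exists_narrow_monomial (fun _ => (1 : ℂ))
      (fun S H hH => stub_prodSparsity _ S (fun _ => (1 : ℂ)) (fun _ _ => one_ne_zero) H hH) hE0
  have hmt : m.support.card ≤ 2 * a * n :=
    (Nat.pow_le_pow_iff_right (by norm_num)).mp (hmcard.trans hEcard)
  -- Step 4: a non-root `1 + w` of `E` with `w` supported on `supp m`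
  obtain ⟨w, hw, hne⟩ := LowSupport.exists_eval_ne_zero_supported hm
  have hne' : eval (fun i => (1 : ℂ) + w i) E ≠ 0 := by
    rwa [ShiftedSupport.eval_shift] at hne
  -- Step 5: the hitting polynomial `f₁ + Σ_{ν ∈ supp m} w_ν x^ν` inside the slice
  obtain ⟨W, hWdef⟩ : ∃ W : degLEMonomials n → ℂ,
      W = fun μ => if h : μ ∈ T then w ⟨μ, h⟩ else 0 := ⟨_, rfl⟩
  have hWval : ∀ i : ↥T, W (i : degLEMonomials n) = w i := by
    intro i
    rw [hWdef]
    dsimp only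
    rw [dif_pos i.2]
  have hST : ∀ μ ∈ m.support.image Subtype.val, μ ∈ T := by
    intro μ hμ
    obtain ⟨i, -, rfl⟩ := Finset.mem_image.mp hμ
    exact i.2
  have hW : ∀ μ, μ ∉ m.support.image Subtype.val → W μ = 0 := by
    intro μ hμ
    rw [hWdef]
    dsimp only
    split_ifs with h
    · exact hw ⟨μ, h⟩ fun hmem => hμ (Finset.mem_image.mpr ⟨⟨μ, h⟩, hmem, rfl⟩)
    · rfl
  have hScard : (m.support.image Subtype.val).card ≤ 2 * a * n :=
    Finset.card_image_le.trans hmt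
  have hfP : f₁ + ∑ μ ∈ m.support.image Subtype.val, monomial (μ : Fin n →₀ ℕ) (W μ) ∈
      coordSlice good :=
    add_sparse_mem_coordSlice hf₁P _ (fun μ hμ => (hT μ).mp (hST μ hμ)) W
  refine ⟨f₁ + ∑ μ ∈ m.support.image Subtype.val, monomial (μ : Fin n →₀ ℕ) (W μ),
    ShiftedSupport.shift_mem_smallCircuits (size_budget3 hn) hf₁S _ hScard W, hfP, ?_⟩
  rw [← eval_subst_of_mem_coordSlice hT hfP D, ← hE, eval_rename,
    ShiftedSupport.coeffVector_shift f₁ _ hW]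
  have hfun : ((fun μ : degLEMonomials n => coeff (μ : Fin n →₀ ℕ) f₁ + W μ) ∘
      (Subtype.val : ↥T → degLEMonomials n)) = fun i : ↥T => 1 + w i := by
    funext i
    rw [Function.comp_apply, hcoef₁ _ ((hT _).mp i.2), hWval]
  rw [hfun]
  exact hne'

/-- Sanity/generalisation check (PROVED-HERE): the landed multilinear theorem
`isSuccinctHittingSetRel_multilinear_sparse` is the instance `good μ := ∀ i, μ i ≤ 1`,
`f₁ := ∏ (1 + x_i)` of the coordinate-slice theorem. [cite: ForbesShpilkaVolk2018, Thm. 9] -/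
theorem multilinear_instance {n a : ℕ} (hn : 8 * a + 2 ≤ n) :
    IsSuccinctHittingSetRel (degLEMonomials n) (multilinearSlice ℂ n) (SmallCircuits ℂ n 3)
      {D | D.support.card ≤ Nat.choose (2 * n) n ^ a} := by
  obtain ⟨hS, hml, hcoef⟩ := stub_multilinearBase n (by omega)
  rw [multilinearSlice_eq_coordSlice]
  refine isSuccinctHittingSetRel_coordSlice_sparse hn _ _ hS hml fun μ hμ => ?_
  rw [hcoef, if_pos hμ]


end CoordSlice

end Summit.ValiantsHypothesis.ValiantsHypothesis.Theorems.BarrierLever.SuccinctHittingSetsForVP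

end
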